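import Summits.KontsevichZagierPeriods.KontsevichZagierPeriods.Theses.MultivaluedCoV

/-!
# Route MultivaluedCoV — `Assembly`: engine + enlarged kernel conjecture imply the summit

Problem `KontsevichZagierPeriods`, route `MultivaluedCoV`, item stmt-KontsevichZagierPeriods-2874
(`Assembly`, assembly, rank 1). The route declaration `Assembly` is the curried implication
`SheetTransfer → MultiCoVKernel → KontsevichZagierPeriods`:

* `SheetTransfer` (the engine, crux 2877): every multivalued change-of-variables relator
  `[σ, Σ_k 1_{σ_k}·(g ∘ Φ_k)·|det Φ_k'|] − N·[τ, g]` of a finite-sheeted `ℚ`-semialgebraic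
  correspondence already lies in `KZ.relations`;
* `MultiCoVKernel` (target, crux 2873): every formal combination `c` with `KZ.eval c = 0` lies in
  the subgroup generated by domain additivity (1a), integrand additivity (1b), Newton–Leibniz (3)
  and those relators;
* conclusion `KontsevichZagierPeriods`: two rational-shape integral representations with equal
  values are `KZ.Equivalent`.

The implication is pure bookkeeping: the three classical generator sets are moves of the calculus
(`KZ.domainAddRel_subset_relations`, `KZ.integrandAddRel_subset_relations`,
`KZ.newtonLeibnizRel_subset_relations`), `SheetTransfer` puts the fourth inside `KZ.relations`,
so `AddSubgroup.closure_le` gives `ker KZ.eval ≤ KZ.relations`; and `r.value = r'.value` is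
`KZ.eval ([r] − [r']) = 0` (`KZ.eval_of`). This is also the type of the route's kernel-checked
deciding theorem `MultivaluedCoV.closes`; the proof here
(`kontsevichZagierPeriods_of_sheetTransfer_of_multiCoVKernel`, twelve lines against the Literature
API) is self-contained, so the result does not depend on the glue theorem's proof term, and
`assembly_proof` is its restatement at the literal route declaration `Assembly`.

Sources: M. Kontsevich, D. Zagier, *Periods* (2001), §1.2 (Conjecture 1, its kernel
reformulation, and the Calabi example of a group law read inside rules 1)–3)). Deliberately NOT
here: any claim about `SheetTransfer` or `MultiCoVKernel` themselves — the result is the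
implication only (unconditional as an implication; `MultiCoVKernel` is GPC-strength).
-/

namespace Summit.KontsevichZagierPeriods.MultivaluedCoV

open Literature.NumberTheory.Transcendental

/-- Route MultivaluedCoV, assembly step, proved directly from the Literature API (no use of the
route's glue theorem): if every multivalued change-of-variables relator is a KZ relation
(`SheetTransfer`) and every value-zero formal combination is generated by moves (1a), (1b), (3) and
those relators (`MultiCoVKernel`), then `KontsevichZagierPeriods` holds. For representations
`r, r'` with equal values, `KZ.eval ([r] - [r']) = 0` by `KZ.eval_of`; `MultiCoVKernel` puts
`[r] - [r']` in the closure of the four generator sets, each of which lies in `KZ.relations`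
(the first three by `KZ.*_subset_relations`, the fourth by `SheetTransfer`), so
`AddSubgroup.closure_le` finishes. [Kontsevich–Zagier 2001, §1.2] [folklore] -/
theorem kontsevichZagierPeriods_of_sheetTransfer_of_multiCoVKernel
    (hT : Summit.KontsevichZagierPeriods.KontsevichZagierPeriods.Theses.MultivaluedCoV.SheetTransfer)
    (hK : Summit.KontsevichZagierPeriods.KontsevichZagierPeriods.Theses.MultivaluedCoV.MultiCoVKernel) :
    KontsevichZagierPeriods := by
  intro n m r r' _ _ hv
  have h0 : KZ.eval (KZ.of r - KZ.of r') = 0 := by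
    rw [map_sub, KZ.eval_of, KZ.eval_of, hv, sub_self]
  have hmem := hK _ h0
  refine (AddSubgroup.closure_le _).mpr ?_ hmem
  rintro c (((hc | hc) | hc) | hc)
  · exact KZ.domainAddRel_subset_relations hc
  · exact KZ.integrandAddRel_subset_relations hc
  · exact KZ.newtonLeibnizRel_subset_relations hc
  · obtain ⟨k, N, ρ, ρ', σ, Φ, Φ', h1, h2, h3, h4, h5, h6, h7, h8, h9, rfl⟩ := hc
    exact hT k N ρ ρ' σ Φ Φ' h1 h2 h3 h4 h5 h6 h7 h8 h9

/-- Settles stmt-KontsevichZagierPeriods-2874: the route declaration `MultivaluedCoV.Assembly`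
(`SheetTransfer → MultiCoVKernel → KontsevichZagierPeriods`) holds — after unfolding it is exactly
`kontsevichZagierPeriods_of_sheetTransfer_of_multiCoVKernel` (equivalently, the route's
kernel-checked deciding theorem `MultivaluedCoV.closes`). [Kontsevich–Zagier 2001, §1.2]
[folklore] -/
theorem assembly_proof :
    Summit.KontsevichZagierPeriods.KontsevichZagierPeriods.Theses.MultivaluedCoV.Assembly := by
  unfold Summit.KontsevichZagierPeriods.KontsevichZagierPeriods.Theses.MultivaluedCoV.Assembly
  exact kontsevichZagierPeriods_of_sheetTransfer_of_multiCoVKernel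

end Summit.KontsevichZagierPeriods.MultivaluedCoV
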